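import Literature.IUT.HodgeTheaters.EtalePictureCore
import Literature.IUT.HodgeTheaters.ThetaHodgeTheaters
import HarnessLib

/-!
# [IUTchI] Remark 3.9.1 for the étale-picture of a Θ-Hodge-theater model (specialisation)

S. Mochizuki, *Inter-universal Teichmüller theory I*, §3, Remark 3.9.1 p. 92
[claim: Mochizuki2012, status: disputed]: "`⁽⁻⁾𝒟⊢_v` constitutes a core" — the one-line
specialisation of the generic discharge `EtalePictureCore.rmk391IsCore_etalePicture` (étale-picture
star ⇒ the centre is a core, over abc-iut-L4-t2/L4-t5's [AbsTopIII] Def. 3.5 files) to the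
étale-picture data of abc-iut-L5-t2's `HodgeTheaterModel M` (Def. 3.6 interface,
`ThetaHodgeTheaters.lean`): labels `n ∈ ℤ`, `ⁿ𝒟_v`-data = the groupoid `M.BaseFull v`,
`𝒟⊢_v`-data = `M.Base v`, "— —" = the functor `M.dashOfBase v : M.BaseFull v ⥤ M.Base v`
("`D_v ↦ D⊢_v` … the relationship — — of the étale-picture, Cor. 3.9 (i)" in that file).
Proof-only; nothing of the series is asserted.
-/

namespace Literature.IUT.HodgeTheaters

open CategoryTheory

universe u v w uM

variable {F : Type u} {K : Type v} {Fbar : Type w} [Field F] [NumberField F] [Field K]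
  [NumberField K] [Algebra F K] [Field Fbar] [Algebra F Fbar] [Algebra K Fbar]
  {E : WeierstrassCurve F} [E.IsElliptic] {l : ℕ} {P : BadPlacePredicates K}
  {D : InitialThetaData F K Fbar E l P}

/-- **[IUTchI] Rmk 3.9.1** (p. 92) for the étale-picture (Cor. 3.9 (i), Fig. 3.2) of a
`HodgeTheaterModel` at `x ∈ V̲`: the observable constituted by the `𝒟⊢_x`-data `M.Base x` with the
relationships "— —" `M.dashOfBase x` from the `ⁿ𝒟_x`-data `M.BaseFull x` (`n ∈ ℤ`) IS A CORE in the
sense of [AbsTopIII] Def. 3.5 (iii) — the slot `S3Local.Rmk391IsCore` holds on this honest context.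
PROVED. [claim: Mochizuki2012, status: disputed] -/
theorem HodgeTheaterModel.rmk391IsCore (M : HodgeTheaterModel.{u, v, w, uM} D) (x : D.V) :
    S3Local.Rmk391IsCore
      (EtalePictureCore.coreContext (ι := ℤ) (fun _ => M.BaseFull x) (M.Base x)
        (fun _ => M.dashOfBase x)) :=
  EtalePictureCore.rmk391IsCore_etalePicture _ _ _

/-- The underlying statement: the étale-picture observable of `M` at `x` is a core
([AbsTopIII] Def. 3.5 (iii), `Observable.IsCore`). PROVED. [claim: Mochizuki2012, status: disputed] -/
theorem HodgeTheaterModel.etaleObservable_isCore (M : HodgeTheaterModel.{u, v, w, uM} D) (x : D.V) :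
    (EtalePictureCore.etaleObservable (ι := ℤ) (fun _ => M.BaseFull x) (M.Base x)
      (fun _ => M.dashOfBase x)).IsCore :=
  EtalePictureCore.etaleObservable_isCore _ _ _

end Literature.IUT.HodgeTheaters
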